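import Literature.Probability.FitznerVanDerHofstad2017.NobleInstantiate
import Literature.Probability.FitznerVanDerHofstad2017.NbwRemainderFrame
import Literature.Probability.FitznerVanDerHofstad2017.NbwRemainderFramePrinted
import HarnessLib

/-!
# The ORACLE RE-CUT `NobleImprovementInputsRemAt` (LEMMAS §20 node N68g; REFEREE v41/v42 R228)

ONE-FILE TEXT OF RECORD (carver ruling, LEMMAS §20 addendum 3 UPDATE 2 (b)): typed by seat lean2-g12, ADOPTED and
filed by seat lean1-g11 with exactly two edits — the print-validity theorems (`a_m ≤ #m-step walks = (2d)^m D^{⋆m}`,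
the generic-majorant frame theorem and its SRW instances `isRemKernelConst_srwK_univ/_of_le/_single`, node
N68c-P) are IMPORTED from `NbwRemainderFramePrinted.lean` instead of being re-proved here, and the record-faithful
valuation `remKsup` of ruling (c2) is stated beside the print-pure `remPrint`.

The improvement-step oracle of record `NobleImprovementInputsAt d cμ c Γ B b` (`NobleInstantiate.lean`,
UNCHANGED — this file adds a NEW declaration beside it and never touches the binders of record) asserts that a
Stage-1 table `(B, b)` is a valid set of [NoBLE17] Assumption 2.7 constants / weighted-diagram bounds at `Γ`.
Inside the published derivation of such a table ([FvdH17] §4 with [NoBLE17] §5.3, Appendix D) the TRAIL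
REMAINDER of a chain with composition `c = (c₁,…,c_n)` (n = number of two-point lines, `M = Σᵢ cᵢ` = the
remainder order),
`Rem_c(p;x) = ((a_{c₁} ⋆ ⋯ ⋆ a_{c_n}) ⋆ τ_p^{⋆n})(x)` (`trailRem d p c x`, raw counts, `NbwRemainderFrame.lean`),
enters ONLY through an upper bound `Rem_c(p;x) ≤ Γ̄₂(p)ⁿ · R` on the endpoint set of the diagram
(`IsRemKernelConst d c X R`): print takes `a_m ≤ (2d)^m D^{⋆m}` and the SRW Fourier bound of [NoBLE17] §5.3.2
(first display), i.e. `R = (2d)^M K_{n,M}` read as `I_{n,M}(0)` / `K_{n,M}(e₁)` — the ten "hooked reads" per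
bootstrap point of the Stage-1 notebook listed in DIVERGENCE.md D55 (cells 5, 8, 11, 12 of `Percolation.nb`);
the N53 variant takes `a_m ≤ b_m` (non-backtracking counts) and `R = J_n` (`nbwJ`, `isRemKernelConst_nbwJ[_single]`).

THE RE-CUT (R228): `NobleImprovementInputsRemAt d CS cμ c Γ R B b` := "IF the ten abstract constants `R r` are
valid remainder-kernel constants for every admissible composition of their read (`RemValid d CS R`), THEN the table
`(B, b)` is a valid improvement-step table at `Γ`" — one binder finer than the oracle of record and of the SAME
epistemic class (REFEREE V1(b): the programme's evaluation of published formulas; NOT CITABLE once `B`, `b`, `R`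
are numerals; every theorem taking it is CONDITIONAL).  What this file proves in the kernel:

* COHERENCE (R228 (2)): `nobleImprovementInputsAt_of_remAt` — for every kernel-valid `R`, the re-cut at `R`
  IMPLIES the oracle of record at the same table; and `remValid_remPrint` — the constants of the PRINTED chain
  (`remPrint d CS`: `(2d)^M K_{n,M}(0)`, at the unit vectors `(2d)^{M} K_{n,M+1}(0) = (2d)^M K_{n,M}(e₁)`) ARE
  kernel-valid for `d ≥ 9` (`a_m ≤ #walks = (2d)^m D^{⋆m}`: `trailLaw_le_wordLaw`, then the generic-majorant
  frame theorem — `isRemKernelConst_srwK_univ` / `isRemKernelConst_srwK_single` of `NbwRemainderFramePrinted.lean`), whence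
  `nobleImprovementInputsAt_of_remAt_print : NobleImprovementInputsRemAt d CS cμ c Γ (remPrint d CS) B b →
  NobleImprovementInputsAt d cμ c Γ B b` with NO further hypothesis: the re-cut SPECIALISES to the oracle of record.
  (The converse direction `nobleImprovementInputsRemAt_of_inputsAt` is trivial: the re-cut is the weaker hypothesis.)
  RECORD-FAITHFUL variant (carver ruling (c2)): `remKsup d CS T` = `remPrint` on rows 1–6 and `(2d)^{CS+1}·T j` on
  the four cell-12 rows, for ANY table `T : Fin 4 → ℝ` with `K_{j+1,CS+1}(x) ≤ T j` for all `x ≠ 0` (hypothesis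
  `hT`, discharged by the tree's certified sup machinery `SrwIntegralSupFinite` — the KSUP reads of the cell of
  record, DIVERGENCE D39/R41); `remValid_remKsup hT` (via `isRemKernelConst_srwK_of_le`) and
  `nobleImprovementInputsAt_of_remAt_ksup`.  This is the valuation at which the slotted recipe (`Stage1CellsRem`,
  part (g2)) reproduces the Stage-1 table of record at rows 7–10; `remPrint` there is the x-UNIFORM majorant.
* N53 DISCHARGE SHAPE (R228 (3)): `remValid_of_nbwJ_le` — a table `R` dominating the NBW integrals `J_n(∏ P_{cᵢ})`
  (uniform kernel; `e₁` kernel for cell 5) over ALL compositions of each read is kernel-valid, by the landed frame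
  theorems `isRemKernelConst_nbwJ` / `isRemKernelConst_nbwJ_single` (N68c-A).  The `J` values themselves must be
  kernel-bounded (`nbwJ_le_of_majorant`, LEMMAS N68e-L) before a row leaves the what-if register.
* STAGE 2 UNCHANGED: `nobleBootstrapBound_of_certificateRem`, `meanField_of_certificateRem`,
  `gamma_eq_one_of_certificateRem` = the theorems of `NobleInstantiate.lean` with `hS` replaced by
  `(hR : RemValid d CS R) (hS : NobleImprovementInputsRemAt d CS cμ c Γ R Bo bo)`.

COMPOSITION RULE typed here = the conservative 'all' rule of D55 (every composition of the read's order `M_r` into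
`n_r` POSITIVE parts; ⊇ the 'struct' rule), so a constant must be valid for all of them.  ENDPOINT SETS: cell 5
`{e_i}` (the `-e_i` follow by the `ℤ^d`-symmetry of `τ_p`), cell 8 `{x : |x|₁ = 2}`, cell 11 `{0}`, cell 12
`{x ≠ 0}` (a sup; hooked with the UNIFORM kernel only — node N68c-S stays open, R228 (3)).

WHAT IS NOT IN THIS FILE (typed-map level, lean2 follow-up `Stage1CellsRem`): the Stage-1 map with the ten reads as
slots, `Data.inpRem y s R`, with `inpRem y s (reads of record) = inpRec y s` by `rfl` — the literal-reproduction
clause of R228 (2) — and its evaluation certificate against an N53 table.  No numerals occur below; no dimension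
sentence is implied; VERDICT-D10 = NO is untouched; `NobleImprovementInputsAt` / `NobleInitialInputsAt` are
byte-unchanged (R-class).
-/

noncomputable section

namespace Literature.Probability.FitznerVanDerHofstad2017

open MeasureTheory Real Finset Filter
open scoped BigOperators
open Literature.Probability.LatticeModels
open Literature.Probability.Percolation
open Literature.Barriers.CriticalPhenomena
open Literature.Barriers.CriticalPhenomena.SpreadOutIsing (delta0 latticeConv convPow)
open Literature.Barriers.CriticalPhenomena.Slade2006Prop53 (P)

variable {d : ℕ}

/-! ### The ten hooked remainder reads (DIVERGENCE.md D55 rows 1–10) -/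

/-- The index of the remainder reads of the Stage-1 notebook that the re-cut abstracts (per bootstrap point;
DIVERGENCE.md D55): `g5` = cell 5 (two-point function at a neighbour, row 1), `g8` = cell 8 (the `G`-reads at
`|x|₁ = 2`, row 2), `cl j` = cell 11, closed repulsive Bubble/Triangle/Square, chains with `j+1` two-point lines
(rows 3–6), `op j` = cell 12, open repulsive polygons, `j+1` lines (rows 7–10).
[cite: FitznerVanDerHofstad2017, notebook Percolation.nb cells 5, 8, 11, 12 (transcript l.305, 336, 386–403, 416–428)] -/
inductive RemRead : Type
  | g5 : RemRead
  | g8 : RemRead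
  | cl : Fin 4 → RemRead
  | op : Fin 4 → RemRead
  deriving DecidableEq

namespace RemRead

/-- Number of two-point lines `n_r` of the read's remainder chain. [cite: FitznerVanDerHofstad2016NoBLE, (5.25)–(5.27) p. 1097] -/
def glines : RemRead → ℕ
  | g5 => 1
  | g8 => 1
  | cl j => (j : ℕ) + 1
  | op j => (j : ℕ) + 1

/-- Total trail order `M_r` of the read at closing length `CS` (`R′ = CS + 2` in the notebook): `CS + 1` for
cell 5 (kernel `·D̂` restored at `x = e₁`) and cell 12, `CS + 2` for cells 8 and 11.
[cite: FitznerVanDerHofstad2017, notebook Percolation.nb cells 5, 8, 11, 12] -/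
def order (CS : ℕ) : RemRead → ℕ
  | g5 => CS + 1
  | g8 => CS + 2
  | cl _ => CS + 2
  | op _ => CS + 1

/-- The admissible compositions of a read ('all' rule, DIVERGENCE.md D55 "composition rule"): every list of
`n_r` POSITIVE parts summing to `M_r`. [cite: FitznerVanDerHofstad2016NoBLE, (5.25)–(5.27) p. 1097] -/
def comps (CS : ℕ) (r : RemRead) : Set (List ℕ) :=
  {c | c.length = r.glines ∧ c.sum = r.order CS ∧ ∀ m ∈ c, 1 ≤ m}

/-- The endpoint set of the read's diagram: `{e_i}` (cell 5), `{x : |x|₁ = 2}` (cell 8), `{0}` (closed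
polygons, cell 11), `{x ≠ 0}` (open polygons, cell 12, a sup).
[cite: FitznerVanDerHofstad2017, notebook Percolation.nb cells 5, 8, 11, 12 (text l.410–415 for the sup)] -/
def pts (d : ℕ) : RemRead → Set (Site d)
  | g5 => Set.range fun i : Fin d => (Pi.single i (1 : ℤ) : Site d)
  | g8 => {x | ∑ i, |x i| = 2}
  | cl _ => {0}
  | op _ => {x | x ≠ 0}

/-- Every read has at most four lines (`2·4 + 1 = 9 ≤ d` is what the Fourier bounds need). [folklore] -/
theorem glines_le_four (r : RemRead) : r.glines ≤ 4 := by
  rcases r with _ | _ | j | j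
  · simp [glines]
  · simp [glines]
  · simp only [glines]; have := j.isLt; omega
  · simp only [glines]; have := j.isLt; omega

/-- Every read has at least one line. [folklore] -/
theorem one_le_glines (r : RemRead) : 1 ≤ r.glines := by
  rcases r with _ | _ | j | j <;> simp [glines]

end RemRead

/-- **Validity of a table of remainder constants**: `R r` is a valid remainder-kernel constant
(`IsRemKernelConst`) for EVERY admissible composition of the read `r`, on the read's endpoint set.
[cite: FitznerVanDerHofstad2016NoBLE, §5.3.2 (first display) p. 1097] -/
def RemValid (d CS : ℕ) (R : RemRead → ℝ) : Prop :=
  ∀ r : RemRead, ∀ c ∈ r.comps CS, IsRemKernelConst d c (r.pts d) (R r)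

namespace RemValid

/-- Valid constants stay valid when enlarged. [folklore] -/
theorem of_le {CS : ℕ} {R R' : RemRead → ℝ} (h : RemValid d CS R) (hle : ∀ r, R r ≤ R' r) :
    RemValid d CS R' :=
  fun r c hc => (h r c hc).of_le (hle r)

/-- The entrywise `min` of two valid tables is valid (the licence for `min(notebook read, NBW read)`).
[folklore] -/
theorem min {CS : ℕ} {R₁ R₂ : RemRead → ℝ} (h₁ : RemValid d CS R₁) (h₂ : RemValid d CS R₂) :
    RemValid d CS fun r => min (R₁ r) (R₂ r) :=
  fun r c hc => (h₁ r c hc).min (h₂ r c hc)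

end RemValid

/-! ### The re-cut oracle -/

/-- **THE RE-CUT IMPROVEMENT-STEP ORACLE** (LEMMAS §20 node N68g, admitted by REFEREE v41 R228) at dimension `d`,
closing length `CS`, bootstrap constants `Γ`, `c_μ`, `c`, abstract remainder constants `R : RemRead → ℝ` and
output table `(B, b)`: IF every `R r` is a valid remainder-kernel constant for its read (`RemValid d CS R`:
`Rem_c(p;x) ≤ Γ̄₂(p)^{n_r} R r` for all subcritical `p`, all `x` in the read's endpoint set, all admissible
compositions `c`), THEN for every `p ∈ (1/(2d-1), p_c)` with `f_i(p) ≤ Γ_i` the two-point function has the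
simplified NoBLE form with Assumption-2.7 constants `B` and the six weighted diagrams are bounded by `b` —
i.e. `NobleImprovementInputsAt d cμ c Γ B b`.  READING (page-located; DIVERGENCE.md D55 is its line-by-line
audit): [FvdH17] §4, (4.18) (the two-point extraction) and [NoBLE17] (5.22)–(5.27), §5.3.2 first display
(TeX `NoBLEAnalysis_rev_fin.tex` l.3085–3125): the published derivation of the coefficient bounds uses the trail
remainder of every chain ONLY through the upper bound `Rem_c ≤ Γ̄₂ⁿ·R` (no lower bound, sign, cancellation or
other property of `D^{⋆M}`), so it goes through verbatim with any valid `R` in place of print's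
`(2d)^M K_{n,M}`; `(B, b)` is then the value of the published Stage-1 formulas with the ten reads replaced by `R`.
**NOT CITABLE once `B`, `b`, `R` are numerals** (REFEREE V1(b), exactly as for `NobleImprovementInputsAt`): with
numeric tables this hypothesis reads "IF these remainder constants are valid THEN this table is a valid set of
Assumption 2.7 constants at `d` for `Γ`", which is the programme's EVALUATION of the published formulas (with the
D55 reads) plus the proof-structure reading above — not a published theorem and not kernel-proved; every theorem
taking it is CONDITIONAL ("kernel modulo the re-cut oracle at the tuple", one binder finer than the sentence of
record, R228 (4)); it is never the oracle of record with `11 → 10`, and no dimension sentence follows from it.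
The binders of record `NobleImprovementInputsAt` / `NobleInitialInputsAt` are unchanged; coherence with them:
`nobleImprovementInputsAt_of_remAt`, `nobleImprovementInputsAt_of_remAt_print`.
[cite: FitznerVanDerHofstad2017, §4.2 (4.18) arXiv:1506.07977v2 p. 36 = EJP p. 33; Prop. 2.2, §2.3–§2.4]
[cite: FitznerVanDerHofstad2016NoBLE, (5.22)–(5.27) and §5.3.2 (first display) p. 1097; Assumption 2.7; Appendix D] -/
def NobleImprovementInputsRemAt (d CS : ℕ) (cμ : ℝ) (c : Fin 6 → ℝ) (Γ : Fin 3 → ℝ)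
    (R : RemRead → ℝ) (B : NobleBeta) (b : Fin 6 → ℝ) : Prop :=
  RemValid d CS R → NobleImprovementInputsAt d cμ c Γ B b

/-- **COHERENCE, general form (R228 (2))**: at any kernel-valid table of remainder constants the re-cut oracle
IMPLIES the oracle of record at the same output table. [folklore] -/
theorem nobleImprovementInputsAt_of_remAt {CS : ℕ} {cμ : ℝ} {c : Fin 6 → ℝ} {Γ : Fin 3 → ℝ}
    {R : RemRead → ℝ} {B : NobleBeta} {b : Fin 6 → ℝ} (hR : RemValid d CS R)
    (hS : NobleImprovementInputsRemAt d CS cμ c Γ R B b) : NobleImprovementInputsAt d cμ c Γ B b :=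
  hS hR

/-- The re-cut is the WEAKER hypothesis: the oracle of record implies it at every `R`. [folklore] -/
theorem nobleImprovementInputsRemAt_of_inputsAt {CS : ℕ} {cμ : ℝ} {c : Fin 6 → ℝ} {Γ : Fin 3 → ℝ}
    (R : RemRead → ℝ) {B : NobleBeta} {b : Fin 6 → ℝ} (hS : NobleImprovementInputsAt d cμ c Γ B b) :
    NobleImprovementInputsRemAt d CS cμ c Γ R B b :=
  fun _ => hS

/-- Antitonicity in the constants: the re-cut at LARGER constants `R'` implies the re-cut at `R ≤ R'`
(validity of `R` gives validity of `R'`). [folklore] -/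
theorem NobleImprovementInputsRemAt.anti {CS : ℕ} {cμ : ℝ} {c : Fin 6 → ℝ} {Γ : Fin 3 → ℝ}
    {R R' : RemRead → ℝ} {B : NobleBeta} {b : Fin 6 → ℝ} (hle : ∀ r, R r ≤ R' r)
    (hS : NobleImprovementInputsRemAt d CS cμ c Γ R' B b) : NobleImprovementInputsRemAt d CS cμ c Γ R B b :=
  fun hR => hS (hR.of_le hle)

/-! ### Stage 2 unchanged: the certificate theorems with the re-cut binder -/

/-- `nobleBootstrapBound_of_certificate` with the improvement oracle re-cut: kernel modulo
`NobleInitialInputsAt`, the re-cut oracle at the tuple, and the validity of `R` (a kernel obligation).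
[cite: FitznerVanDerHofstad2016NoBLE, Prop. 2.11, Def. 2.9] -/
theorem nobleBootstrapBound_of_certificateRem (hd : 2 ≤ d) {CS : ℕ}
    {cμ : ℝ} {c : Fin 6 → ℝ} {γ Γ : Fin 3 → ℝ} {Bi Bo : NobleBeta} {bi bo : Fin 6 → ℝ} {R : RemRead → ℝ}
    (hN : NobleNumericCertificate d cμ c γ Γ Bi Bo bi bo) (hI : NobleInitialInputsAt d Bi bi)
    (hR : RemValid d CS R) (hS : NobleImprovementInputsRemAt d CS cμ c Γ R Bo bo) : NobleBootstrapBound d :=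
  nobleBootstrapBound_of_certificate hd hN hI (hS hR)

/-- `meanField_of_certificate` with the improvement oracle re-cut. [cite: FitznerVanDerHofstad2017, Thm. 1.1, §2.5] -/
theorem meanField_of_certificateRem (hd : 7 ≤ d) {CS : ℕ}
    {cμ : ℝ} {c : Fin 6 → ℝ} {γ Γ : Fin 3 → ℝ} {Bi Bo : NobleBeta} {bi bo : Fin 6 → ℝ} {R : RemRead → ℝ}
    (hN : NobleNumericCertificate d cμ c γ Γ Bi Bo bi bo) (hI : NobleInitialInputsAt d Bi bi)
    (hR : RemValid d CS R) (hS : NobleImprovementInputsRemAt d CS cμ c Γ R Bo bo) :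
    TriangleCondition d ∧ PercolationContinuity d ∧ BetaEqOneBoundedRatio d :=
  meanField_of_certificate hd hN hI (hS hR)

/-- `gamma_eq_one_of_certificate` with the improvement oracle re-cut. [cite: FitznerVanDerHofstad2017, Thm. 1.1 (γ = 1)] -/
theorem gamma_eq_one_of_certificateRem (hd : 7 ≤ d) {CS : ℕ}
    {cμ : ℝ} {c : Fin 6 → ℝ} {γ Γ : Fin 3 → ℝ} {Bi Bo : NobleBeta} {bi bo : Fin 6 → ℝ} {R : RemRead → ℝ}
    (hN : NobleNumericCertificate d cμ c γ Γ Bi Bo bi bo) (hI : NobleInitialInputsAt d Bi bi)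
    (hR : RemValid d CS R) (hS : NobleImprovementInputsRemAt d CS cμ c Γ R Bo bo) :
    ∃ A B δ : ℝ, 0 < A ∧ 0 < B ∧ 0 < δ ∧
      ∀ p : unitInterval, criticalProb (zdGraph d) (0 : Site d) - δ < p →
        (p : ℝ) < criticalProb (zdGraph d) 0 →
          ENNReal.ofReal (A / (criticalProb (zdGraph d) 0 - p)) ≤ expClusterSize (zdGraph d) 0 p ∧
            expClusterSize (zdGraph d) 0 p ≤ ENNReal.ofReal (B / (criticalProb (zdGraph d) 0 - p)) :=
  gamma_eq_one_of_certificate hd hN hI (hS hR)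

/-! ### The printed remainder chain is kernel-valid (imported)

The print-validity theorems — `card_trailWordsTo_le_count` / `trailLaw_le_wordLaw` (`a_m ≤ #m-step walks`),
`wordLaw_eq_polyLaw_X_pow` (`= (2d)^m D^{⋆m}`), the generic-majorant frame theorem `isRemKernelConst_of_majorant`,
the pointwise `trailRem_le_pow_mul_srwK : Rem_c(p;x) ≤ Γ̄₂ⁿ·((2d)^M K_{n,M}(x))` and its instances
`isRemKernelConst_srwK_univ` (`R = (2d)^M K_{n,M}(0)`, x-uniform), `isRemKernelConst_srwK_of_le` (any `T` with
`K_{n,M}(x) ≤ T` on `X`), `isRemKernelConst_srwK_single` (unit vectors, `R = (2d)^M K_{n,M+1}(0)`) — are node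
N68c-P, file `NbwRemainderFramePrinted.lean` (imported above); this file only instantiates them at the ten reads. -/

/-- **The constants of the PRINTED chain** for the ten reads (generic SRW integrals, no numerals):
cell 5 `(2d)^{CS+1} K_{1,CS+1}(e₁) = (2d)^{CS+1} K_{1,CS+2}(0)`; cell 8 `(2d)^{CS+2} K_{1,CS+2}(0)`;
cell 11 `(2d)^{CS+2} K_{n,CS+2}(0)`; cell 12 `(2d)^{CS+1} K_{n,CS+1}(0)` (the `x`-UNIFORM majorant of print's
`sup_{x≠0} K_{n,CS+1}(x)`; print evaluates that sup as `K_{n,CS+1}(e₁)` by [NoBLE17] Lemma 5.1, whose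
`K`-clause is not a kernel theorem — DIVERGENCE.md D39 — and the cell of record reads KSUP there).
For even `M` the notebook's `Ivalue[n,M,{0}] = I_{n,M}(0)` equals `K_{n,M}(0)` (`srwK_zero_even`).
[cite: FitznerVanDerHofstad2016NoBLE, §5.3.2 (first display) p. 1097; (3.35)–(3.36) p. 1071]
[cite: FitznerVanDerHofstad2017, notebook Percolation.nb cells 5, 8, 11, 12] -/
def remPrint (d CS : ℕ) : RemRead → ℝ
  | .g5 => (2 * (d : ℝ)) ^ (CS + 1) * srwK d 1 (CS + 2) 0
  | .g8 => (2 * (d : ℝ)) ^ (CS + 2) * srwK d 1 (CS + 2) 0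
  | .cl j => (2 * (d : ℝ)) ^ (CS + 2) * srwK d ((j : ℕ) + 1) (CS + 2) 0
  | .op j => (2 * (d : ℝ)) ^ (CS + 1) * srwK d ((j : ℕ) + 1) (CS + 1) 0

/-- **The printed chain is kernel-valid** (`d ≥ 9`, so that `2n+1 ≤ d` for chains of `n ≤ 4` lines).
[cite: FitznerVanDerHofstad2016NoBLE, (5.25) p. 1097 and §5.3.2 (first display) p. 1097] -/
theorem remValid_remPrint (hd : 9 ≤ d) (CS : ℕ) : RemValid d CS (remPrint d CS) := by
  have hd2 : 2 ≤ d := by omega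
  rintro (_ | _ | j | j) c ⟨hlen, hsum, -⟩ <;> simp only [RemRead.glines, RemRead.order] at hlen hsum
  · have hn : 2 * c.length + 1 ≤ d := by rw [hlen]; omega
    have h := isRemKernelConst_srwK_single c hn hd2
    rw [hlen, hsum] at h
    exact h
  · have hn : 2 * c.length + 1 ≤ d := by rw [hlen]; omega
    have h := (isRemKernelConst_srwK_univ c hn hd2).mono (Set.subset_univ (RemRead.pts d .g8))
    rw [hlen, hsum] at h
    exact h
  · have hn : 2 * c.length + 1 ≤ d := by rw [hlen]; have := j.isLt; omega
    have h := (isRemKernelConst_srwK_univ c hn hd2).mono (Set.subset_univ (RemRead.pts d (.cl j)))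
    rw [hlen, hsum] at h
    exact h
  · have hn : 2 * c.length + 1 ≤ d := by rw [hlen]; have := j.isLt; omega
    have h := (isRemKernelConst_srwK_univ c hn hd2).mono (Set.subset_univ (RemRead.pts d (.op j)))
    rw [hlen, hsum] at h
    exact h

/-- **COHERENCE AT PRINT (R228 (2))**: the re-cut oracle at the constants of the printed chain IMPLIES the oracle
of record, with no further hypothesis (`d ≥ 9`). [cite: FitznerVanDerHofstad2016NoBLE, §5.3.2 (first display) p. 1097] -/
theorem nobleImprovementInputsAt_of_remAt_print (hd : 9 ≤ d) {CS : ℕ} {cμ : ℝ} {c : Fin 6 → ℝ}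
    {Γ : Fin 3 → ℝ} {B : NobleBeta} {b : Fin 6 → ℝ}
    (hS : NobleImprovementInputsRemAt d CS cμ c Γ (remPrint d CS) B b) : NobleImprovementInputsAt d cμ c Γ B b :=
  hS (remValid_remPrint hd CS)

/-- **The RECORD-FAITHFUL valuation of the ten constants** (carver ruling LEMMAS §20 add. 3 UPDATE 2 (c2)):
rows 1–6 as `remPrint` (even order: `K_{n,M}(0) = I_{n,M}(0) = Ivalue[n,M,{0}]`), and on the four cell-12 rows
`(2d)^{CS+1} · T j` for a table `T : Fin 4 → ℝ` of bounds of `sup_{x≠0} K_{j+1,CS+1}(x)` — the KSUP reads of the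
cell of record (DIVERGENCE D39/R41: print evaluates that sup as `K_{n,CS+1}(e₁)` by [NoBLE17] Lemma 5.1, whose
`K`-clause is not a kernel theorem; the record reads a CERTIFIED sup bound instead).  No numeral: `T` is a binder.
[cite: FitznerVanDerHofstad2016NoBLE, §5.3.2 (first display) p. 1097; Lemma 5.1 p. 1092]
[cite: FitznerVanDerHofstad2017, notebook Percolation.nb cell 12 (text l.410–415)] -/
def remKsup (d CS : ℕ) (T : Fin 4 → ℝ) : RemRead → ℝ
  | .g5 => remPrint d CS .g5
  | .g8 => remPrint d CS .g8
  | .cl j => remPrint d CS (.cl j)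
  | .op j => (2 * (d : ℝ)) ^ (CS + 1) * T j

/-- `remKsup` agrees with `remPrint` off the cell-12 rows. [folklore] -/
theorem remKsup_of_ne_op {CS : ℕ} {T : Fin 4 → ℝ} :
    ∀ r : RemRead, (∀ j, r ≠ .op j) → remKsup d CS T r = remPrint d CS r := by
  rintro (_ | _ | j | j) h
  · rfl
  · rfl
  · rfl
  · exact absurd rfl (h j)

/-- **The record-faithful valuation is kernel-valid** for every table `T` dominating `K_{j+1,CS+1}` off the origin
(`d ≥ 9`): rows 1–6 by `remValid_remPrint`, rows 7–10 by `isRemKernelConst_srwK_of_le`.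
[cite: FitznerVanDerHofstad2016NoBLE, §5.3.2 (first display) p. 1097] -/
theorem remValid_remKsup (hd : 9 ≤ d) (CS : ℕ) {T : Fin 4 → ℝ}
    (hT : ∀ (j : Fin 4) (x : Site d), x ≠ 0 → srwK d ((j : ℕ) + 1) (CS + 1) x ≤ T j) :
    RemValid d CS (remKsup d CS T) := by
  have hd2 : 2 ≤ d := by omega
  have hP := remValid_remPrint hd CS
  rintro (_ | _ | j | j) c hc
  · exact hP _ c hc
  · exact hP _ c hc
  · exact hP _ c hc
  · obtain ⟨hlen, hsum, -⟩ := hc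
    simp only [RemRead.glines, RemRead.order] at hlen hsum
    have hn : 2 * c.length + 1 ≤ d := by rw [hlen]; have := j.isLt; omega
    have hT' : ∀ x ∈ RemRead.pts d (.op j), srwK d c.length c.sum x ≤ T j := by
      intro x hx; rw [hlen, hsum]; exact hT j x hx
    have h := isRemKernelConst_srwK_of_le c hn hd2 hT'
    rw [hsum] at h
    exact h

/-- **COHERENCE AT THE RECORD VALUATION (R228 (2))**: the re-cut oracle at `remKsup d CS T` IMPLIES the oracle of
record, given the sup-table hypothesis `hT` (`d ≥ 9`). [cite: FitznerVanDerHofstad2016NoBLE, §5.3.2 (first display) p. 1097] -/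
theorem nobleImprovementInputsAt_of_remAt_ksup (hd : 9 ≤ d) {CS : ℕ} {T : Fin 4 → ℝ}
    (hT : ∀ (j : Fin 4) (x : Site d), x ≠ 0 → srwK d ((j : ℕ) + 1) (CS + 1) x ≤ T j)
    {cμ : ℝ} {c : Fin 6 → ℝ} {Γ : Fin 3 → ℝ} {B : NobleBeta} {b : Fin 6 → ℝ}
    (hS : NobleImprovementInputsRemAt d CS cμ c Γ (remKsup d CS T) B b) : NobleImprovementInputsAt d cμ c Γ B b :=
  hS (remValid_remKsup hd CS hT)

/-- `remPrint ≥ remKsup` slotwise whenever `T j ≤ K_{j+1,CS+1}(0)` (the x-uniform majorant dominates any sharper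
sup table), so an oracle stated at `remPrint` yields one at `remKsup` (`NobleImprovementInputsRemAt.anti`). [folklore] -/
theorem remKsup_le_remPrint {CS : ℕ} {T : Fin 4 → ℝ}
    (hT0 : ∀ j : Fin 4, T j ≤ srwK d ((j : ℕ) + 1) (CS + 1) 0) : ∀ r, remKsup d CS T r ≤ remPrint d CS r := by
  rintro (_ | _ | j | j)
  · exact le_rfl
  · exact le_rfl
  · exact le_rfl
  · exact mul_le_mul_of_nonneg_left (hT0 j) (by positivity)

/-! ### The N53 discharge: a table dominating the NBW integrals over all compositions is valid -/

/-- **N53 rows** (R228 (3)): if `b_m = polyLaw (Q m)` (the NBW counting polynomials, `hQ`; discharged by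
`card_nbwWordsTo_eq_sum_coeff_srwP`, N68c-G) and the table `R` dominates, read by read, the NBW integrals
`J_n(∏ᵢ Q cᵢ)` of EVERY admissible composition (`e₁` kernel `·X/(2d)` for cell 5, uniform kernel otherwise —
cell 12 included, R228 (3) `--c12 us`), then `R` is kernel-valid.  The frame theorems are `isRemKernelConst_nbwJ`
/ `isRemKernelConst_nbwJ_single` of `NbwRemainderFrame.lean`.
[cite: FitznerVanDerHofstad2016NoBLE, §5.3.2 (first display) p. 1097; (5.25) p. 1097] -/
theorem remValid_of_nbwJ_le (Q : ℕ → Polynomial ℝ) (hQ : ∀ m (y : Site d), nbwLaw d m y = polyLaw d (Q m) y)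
    (hd : 9 ≤ d) {CS : ℕ} {R : RemRead → ℝ}
    (h5 : ∀ c ∈ RemRead.comps CS .g5,
      nbwJ d c.length ((c.map Q).prod * Polynomial.C (1 / (2 * (d : ℝ))) * Polynomial.X) ≤ R .g5)
    (h8 : ∀ c ∈ RemRead.comps CS .g8, nbwJ d c.length (c.map Q).prod ≤ R .g8)
    (hcl : ∀ j : Fin 4, ∀ c ∈ RemRead.comps CS (.cl j), nbwJ d c.length (c.map Q).prod ≤ R (.cl j))
    (hop : ∀ j : Fin 4, ∀ c ∈ RemRead.comps CS (.op j), nbwJ d c.length (c.map Q).prod ≤ R (.op j)) :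
    RemValid d CS R := by
  have hd2 : 2 ≤ d := by omega
  intro r c hc
  have hn : 2 * c.length + 1 ≤ d := by
    have h1 : c.length = r.glines := hc.1
    have := r.glines_le_four
    omega
  rcases r with _ | _ | j | j
  · exact (isRemKernelConst_nbwJ_single Q c hn hd2 hQ).of_le (h5 c hc)
  · exact ((isRemKernelConst_nbwJ Q c hn hd2 hQ).mono (Set.subset_univ _)).of_le (h8 c hc)
  · exact ((isRemKernelConst_nbwJ Q c hn hd2 hQ).mono (Set.subset_univ _)).of_le (hcl j c hc)
  · exact ((isRemKernelConst_nbwJ Q c hn hd2 hQ).mono (Set.subset_univ _)).of_le (hop j c hc)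

/-- The N53 'min' rule: the entrywise `min` of print's constants and an NBW-dominating table is valid, hence the
re-cut at that min-table implies the oracle of record's CONCLUSION at the N53 output table.
[cite: FitznerVanDerHofstad2016NoBLE, §5.3.2 (first display) p. 1097] -/
theorem remValid_min_remPrint (hd : 9 ≤ d) {CS : ℕ} {R : RemRead → ℝ} (hR : RemValid d CS R) :
    RemValid d CS fun r => min (remPrint d CS r) (R r) :=
  (remValid_remPrint hd CS).min hR

/-- The same 'min' rule at the record-faithful valuation. [cite: FitznerVanDerHofstad2016NoBLE, §5.3.2 (first display) p. 1097] -/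
theorem remValid_min_remKsup (hd : 9 ≤ d) {CS : ℕ} {T : Fin 4 → ℝ}
    (hT : ∀ (j : Fin 4) (x : Site d), x ≠ 0 → srwK d ((j : ℕ) + 1) (CS + 1) x ≤ T j)
    {R : RemRead → ℝ} (hR : RemValid d CS R) : RemValid d CS fun r => min (remKsup d CS T r) (R r) :=
  (remValid_remKsup hd CS hT).min hR

end Literature.Probability.FitznerVanDerHofstad2017
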